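import Literature.AnabelianGeometry.SemiGraphs.ApproximatorTransportProofs
import Literature.AnabelianGeometry.SemiGraphs.Coverticial
import Literature.AnabelianGeometry.Anabelioids.FiniteEtaleLocalDictionaryStabilizer
import Literature.AnabelianGeometry.Anabelioids.BCatBranchConjugacy
import Literature.AnabelianGeometry.Anabelioids.ComponentsOrbits
import Literature.AnabelianGeometry.Anabelioids.ComponentsOfObjects
import Literature.AnabelianGeometry.Anabelioids.TerminalCoproductComponents

/-!
# Finite étale coverings of quasi-coherent semi-graphs of anabelioids are quasi-coherent
# ([SemiAnbd] §2, Def. 2.3 (iii) / pp. 29–30; dictionary fact (D5)) — proof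

Mochizuki, *Semi-graphs of anabelioids*, Publ. RIMS **42** (2006), §2 [cite: MochizukiSemiAnbd2006,
Prop. 2.6 p.29]: the proof of Proposition 2.6 "replac[es] `𝒢` by a finite étale covering of `𝒢`",
to which Def. 2.3's quasi-coherence must therefore pass.  We prove the transfer
(`isQuasiCoherent_of_covering`): for `φ' : 𝒢' → 𝒢` satisfying the LOCAL covering predicate
`IsFiniteEtaleCoveringOf A` over a connected quasi-coherent `𝒢`, and `𝒢'` of injective type
((D4), abc-iut-L4-t17), `𝒢'` is quasi-coherent.  Given a collection `U'_{v'} ⊆ Π_{v'}`,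
`U'_{e'} ⊆ Π_{e'}` of open subgroups of index `≤ M` (Def. 2.3 (iii)):

1. every `π₁(φ'_{v'}) : Π_{v'} → Π_v` is injective with open image of index `≤ d` (`d` = the —
   constant — fibre cardinality of `A`; abc-iut-L6-t17 `range_pi1Map_eq_stabilizer`), so the
   `U_v := ⋂_{v' ↦ v} π₁(φ'_{v'})(U'_{v'})` (read in one basepoint of `𝒢_v`) form a collection of
   open subgroups of `𝒢` of index `≤ (M d)^d` (`coveringCollectionPushforward`);
2. an approximator `ψ : 𝒢 → 𝒢₀` splitting it (quasi-coherence of `𝒢`) yields the TRANSPORTED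
   approximator `(φ' ≫ ψ).toImageAnabelioids` of `𝒢'` (`ApproximatorTransport(Proofs)`), which
   splits the `U'` (`transport_splits_of_comap_le`: `Ker ⊆ π₁(φ'_{v'})⁻¹(U_v) ⊆ U'_{v'}`).

No branch alignment is needed (the transported approximator restricts `𝒢'`'s own `b'_*`); the
dictionary wrapper `covering_isQuasiCoherent_holds` (v3 binders) is filed separately.
-/

namespace Literature.AnabelianGeometry.Anabelioids

open CategoryTheory CategoryTheory.Limits CategoryTheory.PreGaloisCategory

universe v₁ u₁

section LocalDegree

variable {C : Type u₁} [Category.{v₁} C] [GaloisCategory C] {D : Type u₁} [Category.{v₁} D]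
  [GaloisCategory D]

omit [GaloisCategory C] [GaloisCategory D] in
/-- `π₁(φ)` is continuous (coordinatewise on `∏ Aut(F X)`). [cite: MochizukiGeoAn2004, Def. 1.1.2(ii) p.10] -/
private theorem continuous_pi1Map'' (P : C ⥤ D) (F : D ⥤ FintypeCat.{v₁}) :
    Continuous (pi1Map P F) := by
  rw [(autEmbedding_isClosedEmbedding (P ⋙ F)).isInducing.continuous_iff, continuous_pi_iff]
  intro B
  have hco : (fun σ : Aut F => autEmbedding (P ⋙ F) (pi1Map P F σ) B) =
      fun σ => autEmbedding F σ (P.obj B) := by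
    funext σ
    exact Iso.ext rfl
  change Continuous fun σ : Aut F => autEmbedding (P ⋙ F) (pi1Map P F σ) B
  rw [hco]
  exact (continuous_apply _).comp (autEmbedding_isClosedEmbedding F).continuous

/-- **The image of an open subgroup of `Π_{v'}` in `Π_v` along a finite étale `φ_{v'}`** (for
`Q ≅ (S × −) ⋙ α`, `α : C_{/S} ⥲ D`, `S` connected, basepoints `F` of `D`, `G ≅ Q ⋙ F` of `C`): it is
an OPEN subgroup of `Π_v = Aut G` of index `[Π_{v'} : U'] · |G(S)|` (`π₁(φ_{v'})` is injective with
image the stabiliser of a point of `G(S)`, [SemiAnbd] Rem. 2.2.1; abc-iut-L6-t17).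
[cite: MochizukiSemiAnbd2006, Rem. 2.2.1 p.24] -/
theorem isOpen_and_index_map_pi1Map {S : C} [IsConnected S] (α : Over S ⥤ D) [α.IsEquivalence]
    {Q : C ⥤ D} (e : Q ≅ Over.star S ⋙ α) (F : D ⥤ FintypeCat.{v₁}) [FiberFunctor F]
    [FiberFunctor (Q ⋙ F)] (G : C ⥤ FintypeCat.{v₁}) [FiberFunctor G] (β : Q ⋙ F ≅ G)
    (U : Subgroup (Aut F)) (hU : IsOpen (U : Set (Aut F))) :
    IsOpen ((U.map ((Aut.autMulEquivOfIso β).toMonoidHom.comp (pi1Map Q F)) : Subgroup (Aut G)) :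
        Set (Aut G)) ∧
      (U.map ((Aut.autMulEquivOfIso β).toMonoidHom.comp (pi1Map Q F))).index =
        U.index * Nat.card (G.obj S) := by
  -- a point of the one-point fibre of `α(S = S)`
  have hT : IsTerminal (α.obj (Over.mk (𝟙 S))) := Over.mkIdTerminal.isTerminalObj α _
  haveI := isConnected_terminal (C := D)
  obtain ⟨t₀⟩ := nonempty_fiber_of_isConnected F (⊤_ D)
  let t : F.obj (α.obj (Over.mk (𝟙 S))) := F.map (hT.uniqueUpToIso terminalIsTerminal).inv t₀
  -- injectivity and the range
  let ι : Aut F →* Aut G := (Aut.autMulEquivOfIso β).toMonoidHom.comp (pi1Map Q F)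
  have hinj : Function.Injective ι :=
    (Aut.autMulEquivOfIso β).injective.comp (pi1Map_injective_of_star_comp α e F)
  have hrange := range_pi1Map_eq_stabilizer α e F β t
  have hindex : (U.map ι).index = U.index * Nat.card (G.obj S) := by
    rw [U.index_map_of_injective hinj]
    change U.index * ((Aut.autMulEquivOfIso β).toMonoidHom.comp (pi1Map Q F)).range.index = _
    rw [hrange, index_stabilizer_fiber]
  refine ⟨?_, hindex⟩
  -- open: closed (compact image) of finite index
  haveI : U.FiniteIndex := by
    haveI : Finite (Aut F ⧸ U) := U.quotient_finite_of_isOpen hU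
    exact Subgroup.finiteIndex_of_finite_quotient
  haveI : (U.map ι).FiniteIndex := by
    refine ⟨?_⟩
    rw [hindex]
    haveI : Finite (G.obj S) := inferInstance
    haveI : Nonempty (G.obj S) := nonempty_fiber_of_isConnected G S
    exact Nat.mul_ne_zero Subgroup.FiniteIndex.index_ne_zero Nat.card_pos.ne'
  refine Subgroup.isOpen_of_isClosed_of_finiteIndex _ ?_
  have hcont : Continuous ι :=
    (continuous_conjAut_of_iso β).comp (continuous_pi1Map'' Q F)
  have hcomp : IsCompact ((U.map ι : Subgroup (Aut G)) : Set (Aut G)) := by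
    rw [Subgroup.coe_map]
    exact ((Subgroup.isClosed_of_isOpen U hU).isCompact).image hcont
  exact hcomp.isClosed

end LocalDegree

/-- The connected components of an object are no more numerous than the points of its fibre
(each component has a point, and distinct components have disjoint fibres).
[cite: MochizukiSemiAnbd2006, Def. 2.2(i) p.23] -/
theorem natCard_π₀Obj_le {C : Type u₁} [Category.{v₁} C] [GaloisCategory C]
    (F : C ⥤ FintypeCat.{v₁}) [FiberFunctor F] (X : C) :
    Nat.card (Literature.AnabelianGeometry.SemiGraphs.π₀Obj X) ≤ Nat.card (F.obj X) := by
  classical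
  haveI : Finite (Literature.AnabelianGeometry.SemiGraphs.π₀Obj X) := finite_connectedSubobject X
  -- pick a point in the fibre-image of each component
  have hpt : ∀ P : Literature.AnabelianGeometry.SemiGraphs.π₀Obj X,
      ∃ x : F.obj X, x ∈ Set.range (F.map P.1.arrow) := fun P => by
    haveI : IsConnected (P.1 : C) := P.2
    obtain ⟨p⟩ := nonempty_fiber_of_isConnected F (P.1 : C)
    exact ⟨F.map P.1.arrow p, p, rfl⟩
  choose pt hpt using hpt
  exact Nat.card_le_card_of_injective pt fun P Q h =>
    component_eq_of_mem_range F P Q (hpt P) (h ▸ hpt Q)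

end Literature.AnabelianGeometry.Anabelioids

namespace Literature.AnabelianGeometry.SemiGraphs

open CategoryTheory CategoryTheory.Limits CategoryTheory.PreGaloisCategory
open Literature.AnabelianGeometry.Anabelioids

universe v₁ u₁ u

namespace SemiGraphOfAnabelioids

variable {𝒢 : SemiGraphOfAnabelioids.{v₁, u₁, u}}

/-- A predicate respected by adjacency is constant along reachability. [folklore] -/
private theorem iff_of_reachable'' {V : Type*} {G : SimpleGraph V} (Q : V → Prop)
    (h : ∀ ⦃a b : V⦄, G.Adj a b → (Q a ↔ Q b)) {u v : V} (huv : G.Reachable u v) : Q u ↔ Q v := by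
  obtain ⟨p⟩ := huv
  induction p with
  | nil => exact Iff.rfl
  | cons hadj _ ih => exact (h hadj).trans ih

/-- The fibre cardinality of the constituent of `A` at a node of the barycentric subdivision
(canonical basepoints) is constant over a connected semi-graph. [cite: MochizukiSemiAnbd2006, Def. 2.2(i) p.23] -/
private theorem natCard_fiber_node_eq (h𝒢 : 𝒢.IsConnected) (A : 𝒢.BObj) (m m' : 𝒢.graph.Node) :
    (match m with
      | Sum.inl v => Nat.card ((GaloisCategory.getFiberFunctor (𝒢.V v)).obj (A.S v))
      | Sum.inr (Sum.inl e) => Nat.card ((GaloisCategory.getFiberFunctor (𝒢.E e)).obj (A.T e))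
      | Sum.inr (Sum.inr b) =>
          Nat.card ((GaloisCategory.getFiberFunctor (𝒢.E (𝒢.graph.edgeOf b))).obj
            (A.T (𝒢.graph.edgeOf b)))) =
    (match m' with
      | Sum.inl v => Nat.card ((GaloisCategory.getFiberFunctor (𝒢.V v)).obj (A.S v))
      | Sum.inr (Sum.inl e) => Nat.card ((GaloisCategory.getFiberFunctor (𝒢.E e)).obj (A.T e))
      | Sum.inr (Sum.inr b) =>
          Nat.card ((GaloisCategory.getFiberFunctor (𝒢.E (𝒢.graph.edgeOf b))).obj
            (A.T (𝒢.graph.edgeOf b)))) := by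
  classical
  let n : 𝒢.graph.Node → ℕ := fun m =>
    match m with
    | Sum.inl v => Nat.card ((GaloisCategory.getFiberFunctor (𝒢.V v)).obj (A.S v))
    | Sum.inr (Sum.inl e) => Nat.card ((GaloisCategory.getFiberFunctor (𝒢.E e)).obj (A.T e))
    | Sum.inr (Sum.inr b) =>
        Nat.card ((GaloisCategory.getFiberFunctor (𝒢.E (𝒢.graph.edgeOf b))).obj
          (A.T (𝒢.graph.edgeOf b)))
  change n m = n m'
  have key : ∀ ⦃m m' : 𝒢.graph.Node⦄, 𝒢.graph.NodeRel m m' → n m = n m' := by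
    rintro _ _ (⟨b⟩ | ⟨b, x, hx⟩)
    · rfl
    · change Nat.card ((GaloisCategory.getFiberFunctor _).obj (A.T (𝒢.graph.edgeOf b))) =
        Nat.card ((GaloisCategory.getFiberFunctor _).obj (A.S x))
      let Fe := GaloisCategory.getFiberFunctor (𝒢.E (𝒢.graph.edgeOf b))
      haveI : FiberFunctor ((𝒢.pull b x hx).pullback ⋙ Fe) := fiberFunctor_comp_of_exact _ _
      obtain ⟨e⟩ := nonempty_iso_of_fiberFunctor ((𝒢.pull b x hx).pullback ⋙ Fe)
        (GaloisCategory.getFiberFunctor (𝒢.V x))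
      rw [← Nat.card_congr (FintypeCat.equivEquivIso.symm (e.app (A.S x))),
        ← Nat.card_congr (FintypeCat.equivEquivIso.symm (Fe.mapIso (A.ψ b x hx)))]
      rfl
  exact (iff_of_reachable'' (fun k => n k = n m') (fun a b hab => by
      rw [SemiGraph.subdivision, SimpleGraph.fromRel_adj] at hab
      rcases hab.2 with hr | hr
      · rw [key hr]
      · rw [← key hr]) (h𝒢.isConnected.connected.preconnected m m')).mpr rfl

/-- `conjAut` and `Aut.autMulEquivOfIso` agree. [folklore] -/
private theorem conjAut_eq_autMulEquivOfIso {C : Type*} [Category C] {X Y : C} (h : X ≅ Y)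
    (σ : Aut X) : h.conjAut σ = Aut.autMulEquivOfIso h σ :=
  Iso.ext (by rw [Iso.conjAut_hom, Iso.conj_apply]; rfl)

/-- Transported subgroups over equal vertices keep openness and index (by `subst`). [folklore] -/
private theorem isOpen_index_eqRec {V : Type u} (T : V → Type*) [∀ v, Group (T v)]
    [∀ v, TopologicalSpace (T v)] {a b : V} (h : a = b) (W : Subgroup (T a)) (N : ℕ)
    (hW : IsOpen (W : Set (T a)) ∧ W.index ≤ N) :
    IsOpen ((h ▸ W : Subgroup (T b)) : Set (T b)) ∧ (h ▸ W : Subgroup (T b)).index ≤ N := by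
  subst h
  exact hW

/-- Membership in a transported subgroup at the reflexive equality. [folklore] -/
private theorem heq_of_eqRec_eq {V : Type u} (T : V → Type*) {a a' b : V} (h : a = b) (h' : a' = b)
    (x : T a) (y : T a') (hxy : (h ▸ x : T b) = h' ▸ y) : HEq x y := by
  subst h; subst h'; exact heq_of_eq hxy

section Main

variable {𝒢' : SemiGraphOfAnabelioids.{v₁, u₁, u}} (φ' : Hom 𝒢' 𝒢) (A : 𝒢.BObj)

/-- **Finite étale coverings of a connected quasi-coherent semi-graph of anabelioids are
quasi-coherent** (given injective type, dictionary fact (D4)): the transport of approximators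
`(φ' ≫ ψ).toImageAnabelioids` splits any collection of coverings of `𝒢'` once `ψ` splits the
pushed-forward collection of `𝒢`. [cite: MochizukiSemiAnbd2006, Prop. 2.6 p.29] -/
theorem isQuasiCoherent_of_covering (h𝒢 : 𝒢.IsConnected) (hloc : φ'.IsFiniteEtaleCoveringOf A)
    (hq : 𝒢.IsQuasiCoherent) (hinj : 𝒢'.IsOfInjectiveType) : 𝒢'.IsQuasiCoherent := by
  classical
  refine ⟨hinj, fun M hM 𝒞' => ?_⟩
  obtain ⟨hprop, cV, cE, hbijV, hbijE, hconV, hconE, -⟩ := hloc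
  haveI := 𝒞'.fiberV
  haveI := 𝒞'.fiberE
  -- basepoints of `𝒢` and frames for the induced basepoints
  let FV : ∀ v : 𝒢.graph.Vertex, 𝒢.V v ⥤ FintypeCat.{v₁} := fun v =>
    GaloisCategory.getFiberFunctor (𝒢.V v)
  let FE : ∀ e : 𝒢.graph.Edge, 𝒢.E e ⥤ FintypeCat.{v₁} := fun e =>
    GaloisCategory.getFiberFunctor (𝒢.E e)
  haveI hfV : ∀ v', FiberFunctor ((φ'.φV v').pullback ⋙ 𝒞'.FV v') := fun v' =>
    fiberFunctor_comp_of_exact _ _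
  haveI hfE : ∀ e', FiberFunctor ((φ'.φE e' (φ'.base.edgeMap e') rfl).pullback ⋙ 𝒞'.FE e') :=
    fun e' => fiberFunctor_comp_of_exact _ _
  have hβV : ∀ v', Nonempty (((φ'.φV v').pullback ⋙ 𝒞'.FV v') ≅ FV (φ'.base.vertexMap v')) :=
    fun v' => nonempty_iso_of_fiberFunctor _ _
  have hβE : ∀ e', Nonempty (((φ'.φE e' (φ'.base.edgeMap e') rfl).pullback ⋙ 𝒞'.FE e') ≅
      FE (φ'.base.edgeMap e')) := fun e' => nonempty_iso_of_fiberFunctor _ _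
  let βV := fun v' => (hβV v').some
  let βE := fun e' => (hβE e').some
  let ιV : ∀ v', Aut (𝒞'.FV v') →* Aut (FV (φ'.base.vertexMap v')) := fun v' =>
    (Aut.autMulEquivOfIso (βV v')).toMonoidHom.comp (pi1Map (φ'.φV v').pullback (𝒞'.FV v'))
  let ιE : ∀ e', Aut (𝒞'.FE e') →* Aut (FE (φ'.base.edgeMap e')) := fun e' =>
    (Aut.autMulEquivOfIso (βE e')).toMonoidHom.comp
      (pi1Map (φ'.φE e' (φ'.base.edgeMap e') rfl).pullback (𝒞'.FE e'))
  have hιV_inj : ∀ v', Function.Injective (ιV v') := fun v' => by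
    obtain ⟨α, hα, ⟨e⟩⟩ := hconV v'; haveI := hα
    exact (Aut.autMulEquivOfIso (βV v')).injective.comp (pi1Map_injective_of_star_comp α e _)
  have hιE_inj : ∀ e', Function.Injective (ιE e') := fun e' => by
    obtain ⟨α, hα, ⟨e⟩⟩ := hconE e'; haveI := hα
    exact (Aut.autMulEquivOfIso (βE e')).injective.comp (pi1Map_injective_of_star_comp α e _)
  -- the degree `d` of `A`
  obtain ⟨n₀⟩ := h𝒢.isConnected.connected.nonempty
  let d : ℕ := match n₀ with
    | Sum.inl v => Nat.card ((GaloisCategory.getFiberFunctor (𝒢.V v)).obj (A.S v))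
    | Sum.inr (Sum.inl e) => Nat.card ((GaloisCategory.getFiberFunctor (𝒢.E e)).obj (A.T e))
    | Sum.inr (Sum.inr b) =>
        Nat.card ((GaloisCategory.getFiberFunctor (𝒢.E (𝒢.graph.edgeOf b))).obj
          (A.T (𝒢.graph.edgeOf b)))
  have hdV : ∀ v, Nat.card ((FV v).obj (A.S v)) = d := fun v =>
    natCard_fiber_node_eq h𝒢 A (Sum.inl v) n₀
  have hdE : ∀ e, Nat.card ((FE e).obj (A.T e)) = d := fun e =>
    natCard_fiber_node_eq h𝒢 A (Sum.inr (Sum.inl e)) n₀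
  -- the fibres of `φ'` on vertices and edges are finite of size `≤ d`
  have hfinπV : ∀ v, Finite (π₀Obj (A.S v)) := fun v => finite_connectedSubobject _
  have hfinπE : ∀ e, Finite (π₀Obj (A.T e)) := fun e => finite_connectedSubobject _
  have hinjfibV : ∀ v, Function.Injective
      (fun x : {v' // φ'.base.vertexMap v' = v} => (x.2 ▸ cV x.1 : π₀Obj (A.S v))) := by
    rintro v ⟨x, hx⟩ ⟨y, hy⟩ hxy
    have : (⟨φ'.base.vertexMap x, cV x⟩ : Σ v, π₀Obj (A.S v)) = ⟨φ'.base.vertexMap y, cV y⟩ :=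
      Sigma.ext (hx.trans hy.symm) (heq_of_eqRec_eq (fun v => π₀Obj (A.S v)) hx hy _ _ hxy)
    exact Subtype.ext (hbijV.1 this)
  have hinjfibE : ∀ e, Function.Injective
      (fun x : {e' // φ'.base.edgeMap e' = e} => (x.2 ▸ cE x.1 : π₀Obj (A.T e))) := by
    rintro e ⟨x, hx⟩ ⟨y, hy⟩ hxy
    have : (⟨φ'.base.edgeMap x, cE x⟩ : Σ e, π₀Obj (A.T e)) = ⟨φ'.base.edgeMap y, cE y⟩ :=
      Sigma.ext (hx.trans hy.symm) (heq_of_eqRec_eq (fun e => π₀Obj (A.T e)) hx hy _ _ hxy)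
    exact Subtype.ext (hbijE.1 this)
  haveI : ∀ v, Finite {v' // φ'.base.vertexMap v' = v} := fun v => .of_injective _ (hinjfibV v)
  haveI : ∀ e, Finite {e' // φ'.base.edgeMap e' = e} := fun e => .of_injective _ (hinjfibE e)
  have hcardfibV : ∀ v, Nat.card {v' // φ'.base.vertexMap v' = v} ≤ d := fun v =>
    (Nat.card_le_card_of_injective _ (hinjfibV v)).trans ((natCard_π₀Obj_le _ _).trans (hdV v).le)
  have hcardfibE : ∀ e, Nat.card {e' // φ'.base.edgeMap e' = e} ≤ d := fun e =>
    (Nat.card_le_card_of_injective _ (hinjfibE e)).trans ((natCard_π₀Obj_le _ _).trans (hdE e).le)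
  -- the pushed-forward subgroups `W v' = ι(U'_{v'})`: open of index `≤ M d`
  let WV : ∀ v', Subgroup (Aut (FV (φ'.base.vertexMap v'))) := fun v' => (𝒞'.UV v').map (ιV v')
  let WE : ∀ e', Subgroup (Aut (FE (φ'.base.edgeMap e'))) := fun e' => (𝒞'.UE e').map (ιE e')
  have hWV : ∀ v', IsOpen (WV v' : Set (Aut (FV (φ'.base.vertexMap v')))) ∧
      (WV v').index ≤ M * d := by
    intro v'
    obtain ⟨α, hα, ⟨e⟩⟩ := hconV v'; haveI := hα
    haveI : PreGaloisCategory.IsConnected ((cV v').1 : 𝒢.V (φ'.base.vertexMap v')) := (cV v').2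
    obtain ⟨hopen, hidx⟩ := isOpen_and_index_map_pi1Map α e (𝒞'.FV v') (FV _) (βV v')
      (𝒞'.UV v') (𝒞'.isOpen_UV v')
    refine ⟨hopen, ?_⟩
    change ((𝒞'.UV v').map (ιV v')).index ≤ M * d
    rw [hidx]
    refine Nat.mul_le_mul (𝒞'.index_UV v') ?_
    rw [← hdV (φ'.base.vertexMap v')]
    exact Nat.card_le_card_of_injective _
      (ConcreteCategory.injective_of_mono_of_preservesPullback ((FV _).map (cV v').1.arrow))
  have hWE : ∀ e', IsOpen (WE e' : Set (Aut (FE (φ'.base.edgeMap e')))) ∧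
      (WE e').index ≤ M * d := by
    intro e'
    obtain ⟨α, hα, ⟨e⟩⟩ := hconE e'; haveI := hα
    haveI : PreGaloisCategory.IsConnected ((cE e').1 : 𝒢.E (φ'.base.edgeMap e')) := (cE e').2
    obtain ⟨hopen, hidx⟩ := isOpen_and_index_map_pi1Map α e (𝒞'.FE e') (FE _) (βE e')
      (𝒞'.UE e') (𝒞'.isOpen_UE e')
    refine ⟨hopen, ?_⟩
    change ((𝒞'.UE e').map (ιE e')).index ≤ M * d
    rw [hidx]
    refine Nat.mul_le_mul (𝒞'.index_UE e') ?_
    rw [← hdE (φ'.base.edgeMap e')]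
    exact Nat.card_le_card_of_injective _
      (ConcreteCategory.injective_of_mono_of_preservesPullback ((FE _).map (cE e').1.arrow))
  -- the collection of `𝒢`: intersections over the fibres
  let UV : ∀ v, Subgroup (Aut (FV v)) := fun v =>
    ⨅ x : {v' // φ'.base.vertexMap v' = v}, (x.2 ▸ WV x.1 : Subgroup (Aut (FV v)))
  let UE : ∀ e, Subgroup (Aut (FE e)) := fun e =>
    ⨅ x : {e' // φ'.base.edgeMap e' = e}, (x.2 ▸ WE x.1 : Subgroup (Aut (FE e)))
  let M₁ : ℕ := max 1 ((M * d) ^ d)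
  have hpow : ∀ k, k ≤ d → (M * d) ^ k ≤ M₁ := fun k hk => by
    rcases Nat.eq_zero_or_pos (M * d) with h0 | hpos
    · have hd0 : d = 0 := by
        rcases Nat.mul_eq_zero.mp h0 with hM0 | hd0
        · omega
        · exact hd0
      have hk0 : k = 0 := by omega
      rw [hk0, pow_zero]
      exact le_max_left _ _
    · exact (Nat.pow_le_pow_right hpos hk).trans (le_max_right _ _)
  have hUV : ∀ v, IsOpen (UV v : Set (Aut (FV v))) ∧ (UV v).index ≤ M₁ := by
    intro v
    haveI : Fintype {v' // φ'.base.vertexMap v' = v} := Fintype.ofFinite _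
    have hx : ∀ x : {v' // φ'.base.vertexMap v' = v},
        IsOpen ((x.2 ▸ WV x.1 : Subgroup (Aut (FV v))) : Set (Aut (FV v))) ∧
          (x.2 ▸ WV x.1 : Subgroup (Aut (FV v))).index ≤ M * d := fun x =>
      isOpen_index_eqRec (fun v => Aut (FV v)) x.2 (WV x.1) (M * d) (hWV x.1)
    refine ⟨?_, ?_⟩
    · change IsOpen ((⨅ x : {v' // φ'.base.vertexMap v' = v},
        (x.2 ▸ WV x.1 : Subgroup (Aut (FV v))) : Subgroup (Aut (FV v))) : Set (Aut (FV v)))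
      rw [Subgroup.coe_iInf]
      exact isOpen_iInter_of_finite fun x => (hx x).1
    · refine (Subgroup.index_iInf_le _).trans ?_
      refine (Finset.prod_le_pow_card _ _ (M * d) fun x _ => (hx x).2).trans ?_
      rw [Finset.card_univ, ← Nat.card_eq_fintype_card]
      exact hpow _ (hcardfibV v)
  have hUE : ∀ e, IsOpen (UE e : Set (Aut (FE e))) ∧ (UE e).index ≤ M₁ := by
    intro e
    haveI : Fintype {e' // φ'.base.edgeMap e' = e} := Fintype.ofFinite _
    have hx : ∀ x : {e' // φ'.base.edgeMap e' = e},
        IsOpen ((x.2 ▸ WE x.1 : Subgroup (Aut (FE e))) : Set (Aut (FE e))) ∧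
          (x.2 ▸ WE x.1 : Subgroup (Aut (FE e))).index ≤ M * d := fun x =>
      isOpen_index_eqRec (fun e => Aut (FE e)) x.2 (WE x.1) (M * d) (hWE x.1)
    refine ⟨?_, ?_⟩
    · change IsOpen ((⨅ x : {e' // φ'.base.edgeMap e' = e},
        (x.2 ▸ WE x.1 : Subgroup (Aut (FE e))) : Subgroup (Aut (FE e))) : Set (Aut (FE e)))
      rw [Subgroup.coe_iInf]
      exact isOpen_iInter_of_finite fun x => (hx x).1
    · refine (Subgroup.index_iInf_le _).trans ?_
      refine (Finset.prod_le_pow_card _ _ (M * d) fun x _ => (hx x).2).trans ?_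
      rw [Finset.card_univ, ← Nat.card_eq_fintype_card]
      exact hpow _ (hcardfibE e)
  let 𝒞 : CoveringCollection 𝒢 M₁ :=
    { FV := FV, fiberV := fun _ => inferInstance, FE := FE, fiberE := fun _ => inferInstance,
      UV := UV, UE := UE,
      isOpen_UV := fun v => (hUV v).1, isOpen_UE := fun e => (hUE e).1,
      index_UV := fun v => (hUV v).2, index_UE := fun e => (hUE e).2 }
  -- an approximator of `𝒢` splitting `𝒞`, transported to `𝒢'`
  obtain ⟨𝒢₀, ψ, happ, hsplit⟩ := hq.exists_approximator M₁ (le_max_left _ _) 𝒞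
  refine ⟨_, (φ'.comp ψ).toImageAnabelioids,
    (transport_isPi1EpiApproximator φ' ψ happ.isOfBoundedOrder).isApproximator, ?_⟩
  refine transport_splits_of_comap_le φ' ψ 𝒞' (fun v' => ?_) (fun e' => ?_)
  · -- vertices: `Ker ⊆ ι⁻¹(U_v) ⊆ U'_{v'}`
    intro τ hτ
    rw [Subgroup.mem_comap, MonoidHom.mem_ker] at hτ
    have hK : (βV v').conjAut (pi1Map (φ'.φV v').pullback (𝒞'.FV v') τ) ∈ 𝒞.UV (φ'.base.vertexMap v') := by
      apply hsplit.1
      rw [MonoidHom.mem_ker, pi1Map_conjAut, hτ, map_one]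
    have hW : (βV v').conjAut (pi1Map (φ'.φV v').pullback (𝒞'.FV v') τ) ∈ WV v' := by
      have := (iInf_le (fun x : {w // φ'.base.vertexMap w = φ'.base.vertexMap v'} =>
        (x.2 ▸ WV x.1 : Subgroup (Aut (FV (φ'.base.vertexMap v'))))) ⟨v', rfl⟩) hK
      exact this
    rw [conjAut_eq_autMulEquivOfIso] at hW
    exact (Subgroup.mem_map_iff_mem (hιV_inj v')).mp hW
  · intro τ hτ
    rw [Subgroup.mem_comap, MonoidHom.mem_ker] at hτ
    have hK : (βE e').conjAut (pi1Map (φ'.φE e' (φ'.base.edgeMap e') rfl).pullback (𝒞'.FE e') τ) ∈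
        𝒞.UE (φ'.base.edgeMap e') := by
      apply hsplit.2
      rw [MonoidHom.mem_ker, pi1Map_conjAut, hτ, map_one]
    have hW : (βE e').conjAut (pi1Map (φ'.φE e' (φ'.base.edgeMap e') rfl).pullback (𝒞'.FE e') τ) ∈
        WE e' := by
      have := (iInf_le (fun x : {f // φ'.base.edgeMap f = φ'.base.edgeMap e'} =>
        (x.2 ▸ WE x.1 : Subgroup (Aut (FE (φ'.base.edgeMap e'))))) ⟨e', rfl⟩) hK
      exact this
    rw [conjAut_eq_autMulEquivOfIso] at hW
    exact (Subgroup.mem_map_iff_mem (hιE_inj e')).mp hW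

end Main

end SemiGraphOfAnabelioids

end Literature.AnabelianGeometry.SemiGraphs
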